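import Summits.BirchSwinnertonDyer.Rank1Residual.Supersingular.CountPointsFast
import HarnessLib

/-!
# Kernel CYCLICITY CERTIFICATE for the `p`-part of `Ẽ(𝔽_ℓ)` when `p² ∣ #Ẽ(𝔽_ℓ)`: an explicit point whose
# `(#Ẽ/p)`-multiple is non-zero, by a division-free double-and-add LADDER (TOOL)

Cell `b2b-bsdres`, supersingular family, prover A = unit `b2b-bsdres-x10b` (gen 13).  Topic file; namespace
`Summit.BirchSwinnertonDyer.Rank1Residual.Supersingular`.  TOOL: elementary group theory + the chord/tangent
law of a Weierstrass curve over `𝔽_ℓ`; small computable definitions (`LadderStep`, `dblOK`, `addOK`,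
`ladderRun`, `ladderScalar`, `ladderCheck`) and their soundness; no named fact, no `Prop` minted, nothing booked.

HONEST FRAMING (run/shared/lean/b2b/bsd-rank1-residual/, verbatim in every file): the goal of the
cell is to DELETE the COMBINATION-SHAPED residual classes of the Birch–Swinnerton-Dyer formula for
ALL analytic-rank `≤ 1` elliptic curves over `ℚ` — "full BSD formula for every rank `≤ 1` curve in
class `C`" assembled STRICTLY from published theorems — so that the rank-`≤ 1` remainder becomes
exactly the CONSTRUCTION-SHAPED classes, which are TYPED (missing-input `Prop`s), NOT attempted.
This is not "finishing BSD".  Classes X6 / X7 / X8 stay CONSTRUCTION-SHAPED; nothing here moves a label.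

## What this file is for

Every Kurihara-number consumer of the cell (Kim, AJM 148 (2026) Thm. 1.9 (6) / 1.10 (1); the `_OPEN`
Kim 2025 shapes at `p = 3`) carries, for each prime `ℓ` of the Kolyvagin level `n`, the CYCLICITY binder
`Nat.card {P : Ẽ(𝔽_ℓ) // p • P = 0} ≤ p` (the `p`-primary part of `Ẽ(𝔽_ℓ)` is cyclic).  The tree decides it
from a point count when `p² ∤ #Ẽ(𝔽_ℓ)` (`Additive.natCard_nsmul_eq_zero_le_of_not_sq_dvd_card`), and at
`p = 3` in general (`Ψ₃`-root / cube test).  At `p ≥ 5` with `p² ∣ #Ẽ(𝔽_ℓ)` the count is silent and the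
N4 / N5 per-pair OFFERS (`X6KuriharaOfferRecordsCyc*`, `X7KuriharaOfferRecordsCyc*`: 22 + 89 cells) carried
cyclicity as the DATA binder `hcyc` (PARI `ellgroup`, two engines in-job).  This file makes it a kernel
certificate in that case too, uniformly in `p`:

* §1 `natCard_torsion_le_of_nsmul_ne_zero` — in a finite abelian group `G` of order `N` with `p ∣ N`, ONE
  element `g` with `(N/p) • g ≠ 0` forces `#G[p] ≤ p`.  (The order `o` of `g` then carries the full power
  of `p` dividing `N`, so `G / ⟨g⟩` has order prime to `p` and every `p`-torsion element lies in the cyclic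
  group `⟨g⟩`, which has at most `p` of them.)
* §2 the LADDER: `ladderRun` replays a left-to-right binary double-and-add chain for `m • P₀` on the
  reduction `Ẽ = E mod ℓ` of a literal integer model, every step being the generic chord / tangent case with
  its slope SUPPLIED and checked division-free (`dblOK`, `addOK`: `L·D = N`, then the `addX` / `addY`
  polynomials of Mathlib); soundness `ladderRun_sound`: if the run succeeds then
  `(ladderScalar 1 steps) • P₀ = (x_f, y_f)` is an affine point, hence `≠ O`.
* §3 `card_torsion_le_of_ladder` — the RECORD form: a literal model `[a₁,…,a₆]`, a prime `ℓ ≠ 2`, `ℓ ∤ Δ`,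
  the schema count `countPoints [a₁,…,a₆] ℓ = n`, and a ladder certificate with `ladderScalar · p = n`
  give the binder in the exact shape the offer shapes quantify; plus the count form
  `card_torsion_le_of_count` (`p² ∤ n`) for the literal model and the level dispatchers
  `forall_card_torsion_le_of_level` / `_of_prime_level` — a two-prime level gets `hcyc` from any mix of the two.

References: J. H. Silverman, *The Arithmetic of Elliptic Curves*, 2nd ed., GTM 106 (2009), III.2.3 (group law,
duplication formula) [SilvermanAEC2009]; C.-H. Kim, AJM 148 (2026) §1.2.2, Thm. 1.10 (1) (the cyclic reduction
condition on Kolyvagin primes) [Kim2022StructureSelmer].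
-/

set_option autoImplicit false

open WeierstrassCurve Literature.NumberTheory.EllipticCurves.Rank1Residual.X11RankOneCertificates

namespace Summit.BirchSwinnertonDyer.Rank1Residual.Supersingular

/-! ### §1 One element of large order bounds the `p`-torsion -/

section Group

/-- **In a finite abelian group `G` of order `N`, an element `g` with `(N/p) • g ≠ 0` forces
`#G[p] ≤ p`.**  Proof: the order `o ∣ N` of `g` does not divide `N/p`, so `p ∤ #(G/⟨g⟩) = N/o`; hence the
image of any `p`-torsion `x` in `G/⟨g⟩` (of order `∣ p`) is trivial, i.e. `G[p] ⊆ ⟨g⟩`, a cyclic group,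
which has at most `p` elements killed by `p`. [cite: Kim2022StructureSelmer, §1.2.2 and Thm. 1.10 (1)] -/
theorem natCard_torsion_le_of_nsmul_ne_zero {G : Type*} [AddCommGroup G] [Finite G] {p N : ℕ}
    (hp : p.Prime) (hN : Nat.card G = N) {g : G} (hg : (N / p) • g ≠ 0) :
    Nat.card {x : G // p • x = 0} ≤ p := by
  classical
  set H : AddSubgroup G := AddSubgroup.zmultiples g with hH_def
  have hH : Nat.card H = addOrderOf g := Nat.card_zmultiples g
  have hnot : ¬ addOrderOf g ∣ N / p := fun h => hg (addOrderOf_dvd_iff_nsmul_eq_zero.mp h)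
  have hq : N = Nat.card (G ⧸ H) * addOrderOf g := by
    rw [← hN, ← hH]; exact AddSubgroup.card_eq_card_quotient_mul_card_addSubgroup H
  -- every `p`-torsion element lies in `H = ⟨g⟩`
  have hmem : ∀ x : G, p • x = 0 → x ∈ H := by
    intro x hx
    have h1 : addOrderOf (x : G ⧸ H) ∣ p :=
      addOrderOf_dvd_iff_nsmul_eq_zero.mpr (by rw [← QuotientAddGroup.mk_nsmul, hx, QuotientAddGroup.mk_zero])
    rcases (Nat.dvd_prime hp).mp h1 with h1 | h1
    · exact (QuotientAddGroup.eq_zero_iff x).mp (AddMonoid.addOrderOf_eq_one_iff.mp h1)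
    · exfalso
      have hdvd : p ∣ Nat.card (G ⧸ H) := h1 ▸ addOrderOf_dvd_natCard _
      obtain ⟨t, ht⟩ := hdvd
      apply hnot
      refine ⟨t, ?_⟩
      rw [hq, ht, mul_assoc, Nat.mul_div_cancel_left _ hp.pos, mul_comm]
  -- inject `G[p]` into `H[p]` and count inside the cyclic group `H`
  haveI : Fintype H := Fintype.ofFinite H
  have hinj : Nat.card {x : G // p • x = 0} ≤ Nat.card {h : H // p • h = 0} := by
    refine Nat.card_le_card_of_injective
      (fun x => ⟨⟨x.1, hmem x.1 x.2⟩, Subtype.ext (by simp [x.2])⟩) ?_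
    intro a b h
    have := congrArg (fun z : {h : H // p • h = 0} => ((z.1 : H) : G)) h
    exact Subtype.ext (by simpa using this)
  have hcyc : Nat.card {h : H // p • h = 0} ≤ p := by
    rw [Nat.card_eq_fintype_card, Fintype.card_subtype]
    exact IsAddCyclic.card_nsmul_eq_zero_le hp.pos
  exact hinj.trans hcyc

/-- Count form for any finite abelian group, restated here for the literal-model record shape:
`p² ∤ #G ⟹ #G[p] ≤ p` (the tree's `Additive.natCard_nsmul_eq_zero_le_of_not_sq_dvd_card`, re-proved in
three lines from §1's sibling facts to keep this tool's import light). [cite: Kim2022StructureSelmer, §1.2.2 and Thm. 1.10 (1)] -/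
theorem natCard_torsion_le_of_not_sq_dvd {G : Type*} [AddCommGroup G] [Finite G] {p : ℕ}
    (hp : p.Prime) (h : ¬ p ^ 2 ∣ Nat.card G) : Nat.card {x : G // p • x = 0} ≤ p := by
  classical
  haveI : Fact p.Prime := ⟨hp⟩
  set H : AddSubgroup G := AddSubgroup.torsionBy G p
  have hmem : ∀ x : G, p • x = 0 ↔ x ∈ H := fun x => AddSubgroup.torsionBy.nsmul_iff.symm
  rw [Nat.card_congr (Equiv.subtypeEquivRight hmem)]
  have hP : IsPGroup p (Multiplicative H) := by
    intro x
    refine ⟨1, ?_⟩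
    apply Multiplicative.toAdd.injective
    rw [pow_one, toAdd_pow, toAdd_one]
    exact AddSubgroup.torsionBy.nsmul (Multiplicative.toAdd x)
  haveI : Finite (Multiplicative H) := Finite.of_equiv H Multiplicative.ofAdd
  obtain ⟨n, hn⟩ := IsPGroup.iff_card.mp hP
  have hn' : Nat.card H = p ^ n := by rw [← hn]; exact Nat.card_congr Multiplicative.ofAdd
  have hdvd : Nat.card H ∣ Nat.card G := AddSubgroup.card_addSubgroup_dvd_card H
  rw [hn'] at hdvd ⊢
  have hn1 : n ≤ 1 := by
    by_contra hlt
    exact h (dvd_trans (pow_dvd_pow p (by omega)) hdvd)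
  calc p ^ n ≤ p ^ 1 := Nat.pow_le_pow_right hp.pos hn1
    _ = p := pow_one p

end Group

/-! ### §2 The division-free double-and-add ladder on `E mod ℓ` -/

section Ladder

/-- One step of the left-to-right binary ladder for `m • P₀`: DOUBLE the accumulator (tangent slope `ld`,
result `(xd, yd)`), then, if `bit`, ADD the base point `P₀` (chord slope `la`, result `(xa, ya)`); for
`bit = false` the fields `la, xa, ya` are ignored.  Integer entries, read mod `ℓ`. [cite: SilvermanAEC2009, III.2.3] -/
structure LadderStep where
  /-- the binary digit of the scalar consumed by this step -/ bit : Bool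
  /-- tangent slope of the doubling -/ ld : ℤ
  /-- `x` after doubling -/ xd : ℤ
  /-- `y` after doubling -/ yd : ℤ
  /-- chord slope of the addition of the base point (if `bit`) -/ la : ℤ
  /-- `x` after the addition (if `bit`) -/ xa : ℤ
  /-- `y` after the addition (if `bit`) -/ ya : ℤ

/-- Division-free TANGENT check on `V mod ℓ`: `D = 2y₁ + a₁x₁ + a₃ ≠ 0`, `L·D = 3x₁² + 2a₂x₁ + a₄ − a₁y₁`,
and `(x₃, y₃)` are Mathlib's `addX x₁ x₁ L`, `addY x₁ x₁ y₁ L`. [cite: SilvermanAEC2009, III.2.3] -/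
def dblOK (V : WeierstrassCurve ℤ) (ℓ : ℕ) (x₁ y₁ L x₃ y₃ : ZMod ℓ) : Bool :=
  decide (2 * y₁ + (V.a₁ : ZMod ℓ) * x₁ + (V.a₃ : ZMod ℓ) ≠ 0) &&
  decide (L * (2 * y₁ + (V.a₁ : ZMod ℓ) * x₁ + (V.a₃ : ZMod ℓ)) =
    3 * x₁ ^ 2 + 2 * (V.a₂ : ZMod ℓ) * x₁ + (V.a₄ : ZMod ℓ) - (V.a₁ : ZMod ℓ) * y₁) &&
  decide (x₃ = L ^ 2 + (V.a₁ : ZMod ℓ) * L - (V.a₂ : ZMod ℓ) - x₁ - x₁) &&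
  decide (y₃ = -(L * (x₃ - x₁) + y₁) - (V.a₁ : ZMod ℓ) * x₃ - (V.a₃ : ZMod ℓ))

/-- Division-free CHORD check on `V mod ℓ`: `x₁ ≠ x₂`, `L·(x₁ − x₂) = y₁ − y₂`, and `(x₃, y₃)` are Mathlib's
`addX x₁ x₂ L`, `addY x₁ x₂ y₁ L`. [cite: SilvermanAEC2009, III.2.3] -/
def addOK (V : WeierstrassCurve ℤ) (ℓ : ℕ) (x₁ y₁ x₂ y₂ L x₃ y₃ : ZMod ℓ) : Bool :=
  decide (x₁ ≠ x₂) &&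
  decide (L * (x₁ - x₂) = y₁ - y₂) &&
  decide (x₃ = L ^ 2 + (V.a₁ : ZMod ℓ) * L - (V.a₂ : ZMod ℓ) - x₁ - x₂) &&
  decide (y₃ = -(L * (x₃ - x₁) + y₁) - (V.a₁ : ZMod ℓ) * x₃ - (V.a₃ : ZMod ℓ))

/-- Replay of the ladder from the accumulator `(x, y)` with base point `(x₀, y₀)`: `some (x_f, y_f)` if every
step passes its check, `none` otherwise. [cite: SilvermanAEC2009, III.2.3] -/
def ladderRun (V : WeierstrassCurve ℤ) (ℓ : ℕ) (x₀ y₀ : ZMod ℓ) :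
    ZMod ℓ → ZMod ℓ → List LadderStep → Option (ZMod ℓ × ZMod ℓ)
  | x, y, [] => some (x, y)
  | x, y, s :: rest =>
    if dblOK V ℓ x y (s.ld : ZMod ℓ) (s.xd : ZMod ℓ) (s.yd : ZMod ℓ) then
      if s.bit then
        (if addOK V ℓ (s.xd : ZMod ℓ) (s.yd : ZMod ℓ) x₀ y₀ (s.la : ZMod ℓ) (s.xa : ZMod ℓ) (s.ya : ZMod ℓ) then
          ladderRun V ℓ x₀ y₀ (s.xa : ZMod ℓ) (s.ya : ZMod ℓ) rest else none)
      else ladderRun V ℓ x₀ y₀ (s.xd : ZMod ℓ) (s.yd : ZMod ℓ) rest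
    else none

/-- The scalar computed by the ladder: `k ↦ 2k + bit` per step. [folklore] -/
def ladderScalar : ℕ → List LadderStep → ℕ
  | k, [] => k
  | k, s :: rest => ladderScalar (2 * k + (if s.bit then 1 else 0)) rest

/-- The complete certificate check: `(x₀, y₀)` satisfies the Weierstrass equation of `V` mod `ℓ` and the
ladder from `(x₀, y₀)` runs to the end (ends in an AFFINE point). [cite: SilvermanAEC2009, III.2.3] -/
def ladderCheck (V : WeierstrassCurve ℤ) (ℓ : ℕ) (x₀ y₀ : ℤ) (steps : List LadderStep) : Bool :=
  decide ((y₀ : ZMod ℓ) ^ 2 + (V.a₁ : ZMod ℓ) * (x₀ : ZMod ℓ) * (y₀ : ZMod ℓ) + (V.a₃ : ZMod ℓ) * (y₀ : ZMod ℓ) =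
    (x₀ : ZMod ℓ) ^ 3 + (V.a₂ : ZMod ℓ) * (x₀ : ZMod ℓ) ^ 2 + (V.a₄ : ZMod ℓ) * (x₀ : ZMod ℓ) + (V.a₆ : ZMod ℓ)) &&
  (ladderRun V ℓ (x₀ : ZMod ℓ) (y₀ : ZMod ℓ) (x₀ : ZMod ℓ) (y₀ : ZMod ℓ) steps).isSome

variable (V : WeierstrassCurve ℤ) (ℓ : ℕ)

/-- The coefficients of `V mod ℓ` are the casts of those of `V`. [folklore] -/
theorem map_a_eq :
    (V.map (Int.castRingHom (ZMod ℓ))).a₁ = (V.a₁ : ZMod ℓ) ∧ (V.map (Int.castRingHom (ZMod ℓ))).a₂ = (V.a₂ : ZMod ℓ) ∧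
      (V.map (Int.castRingHom (ZMod ℓ))).a₃ = (V.a₃ : ZMod ℓ) ∧ (V.map (Int.castRingHom (ZMod ℓ))).a₄ = (V.a₄ : ZMod ℓ) ∧
      (V.map (Int.castRingHom (ZMod ℓ))).a₆ = (V.a₆ : ZMod ℓ) := by
  refine ⟨?_, ?_, ?_, ?_, ?_⟩ <;> simp [WeierstrassCurve.map]

variable {V ℓ}

/-- Two affine points with equal coordinates are equal (proof irrelevance in `Point.some`). [folklore] -/
theorem exists_some_eq_of_eq {x y x' y' : ZMod ℓ} (h : (V.map (Int.castRingHom (ZMod ℓ))).toAffine.Nonsingular x y)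
    (hx : x = x') (hy : y = y') :
    ∃ h' : (V.map (Int.castRingHom (ZMod ℓ))).toAffine.Nonsingular x' y',
      (Affine.Point.some x y h : (V.map (Int.castRingHom (ZMod ℓ))).toAffine.Point) = Affine.Point.some x' y' h' := by
  subst hx hy; exact ⟨h, rfl⟩

variable [Fact ℓ.Prime]

/-- **Soundness of the tangent check**: `dblOK x₁ y₁ L x₃ y₃ ⟹ (x₁,y₁) + (x₁,y₁) = (x₃,y₃)` on `V mod ℓ`.
[cite: SilvermanAEC2009, III.2.3] -/
theorem add_self_eq_of_dblOK {x₁ y₁ L x₃ y₃ : ZMod ℓ}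
    (h₁ : (V.map (Int.castRingHom (ZMod ℓ))).toAffine.Nonsingular x₁ y₁)
    (hok : dblOK V ℓ x₁ y₁ L x₃ y₃ = true) :
    ∃ h₃ : (V.map (Int.castRingHom (ZMod ℓ))).toAffine.Nonsingular x₃ y₃,
      (Affine.Point.some x₁ y₁ h₁ : (V.map (Int.castRingHom (ZMod ℓ))).toAffine.Point) + Affine.Point.some x₁ y₁ h₁ =
        Affine.Point.some x₃ y₃ h₃ := by
  obtain ⟨ha₁, ha₂, ha₃, ha₄, -⟩ := map_a_eq V ℓ
  simp only [dblOK, Bool.and_eq_true, decide_eq_true_eq] at hok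
  obtain ⟨⟨⟨hD, hL⟩, hx₃⟩, hy₃⟩ := hok
  have hDval : y₁ - (V.map (Int.castRingHom (ZMod ℓ))).toAffine.negY x₁ y₁ =
      2 * y₁ + (V.a₁ : ZMod ℓ) * x₁ + (V.a₃ : ZMod ℓ) := by
    simp only [Affine.negY, ha₁, ha₃]; ring
  have hy : y₁ ≠ (V.map (Int.castRingHom (ZMod ℓ))).toAffine.negY x₁ y₁ := by
    intro h; apply hD; rw [← hDval, sub_eq_zero.mpr h]
  have hslope : (V.map (Int.castRingHom (ZMod ℓ))).toAffine.slope x₁ x₁ y₁ y₁ = L := by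
    rw [Affine.slope_of_Y_ne rfl hy, hDval, ha₁, ha₂, ha₄, div_eq_iff hD, hL]
  rw [Affine.Point.add_self_of_Y_ne hy]
  refine exists_some_eq_of_eq _ ?_ ?_
  · rw [hslope, hx₃]; simp only [Affine.addX, ha₁, ha₂]
  · rw [hslope, hy₃, hx₃]
    simp only [Affine.addY, Affine.negAddY, Affine.addX, Affine.negY, ha₁, ha₂, ha₃]

/-- **Soundness of the chord check**: `addOK x₁ y₁ x₂ y₂ L x₃ y₃ ⟹ (x₁,y₁) + (x₂,y₂) = (x₃,y₃)` on `V mod ℓ`.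
[cite: SilvermanAEC2009, III.2.3] -/
theorem add_eq_of_addOK {x₁ y₁ x₂ y₂ L x₃ y₃ : ZMod ℓ}
    (h₁ : (V.map (Int.castRingHom (ZMod ℓ))).toAffine.Nonsingular x₁ y₁)
    (h₂ : (V.map (Int.castRingHom (ZMod ℓ))).toAffine.Nonsingular x₂ y₂)
    (hok : addOK V ℓ x₁ y₁ x₂ y₂ L x₃ y₃ = true) :
    ∃ h₃ : (V.map (Int.castRingHom (ZMod ℓ))).toAffine.Nonsingular x₃ y₃,
      (Affine.Point.some x₁ y₁ h₁ : (V.map (Int.castRingHom (ZMod ℓ))).toAffine.Point) + Affine.Point.some x₂ y₂ h₂ =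
        Affine.Point.some x₃ y₃ h₃ := by
  obtain ⟨ha₁, ha₂, ha₃, -, -⟩ := map_a_eq V ℓ
  simp only [addOK, Bool.and_eq_true, decide_eq_true_eq] at hok
  obtain ⟨⟨⟨hx, hL⟩, hx₃⟩, hy₃⟩ := hok
  have hslope : (V.map (Int.castRingHom (ZMod ℓ))).toAffine.slope x₁ x₂ y₁ y₂ = L := by
    rw [Affine.slope_of_X_ne hx, div_eq_iff (sub_ne_zero.mpr hx), hL]
  rw [Affine.Point.add_of_X_ne hx]
  refine exists_some_eq_of_eq _ ?_ ?_
  · rw [hslope, hx₃]; simp only [Affine.addX, ha₁, ha₂]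
  · rw [hslope, hy₃, hx₃]
    simp only [Affine.addY, Affine.negAddY, Affine.addX, Affine.negY, ha₁, ha₂, ha₃]

/-- **Soundness of the ladder**: if `k • P₀ = (x, y)` and the run from `(x, y)` succeeds, then
`(ladderScalar k steps) • P₀` is the affine point the run ends in. [cite: SilvermanAEC2009, III.2.3] -/
theorem ladderRun_sound {x₀ y₀ : ZMod ℓ} (h₀ : (V.map (Int.castRingHom (ZMod ℓ))).toAffine.Nonsingular x₀ y₀) :
    ∀ (steps : List LadderStep) (k : ℕ) (x y : ZMod ℓ)
      (h : (V.map (Int.castRingHom (ZMod ℓ))).toAffine.Nonsingular x y),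
      k • (Affine.Point.some x₀ y₀ h₀ : (V.map (Int.castRingHom (ZMod ℓ))).toAffine.Point) = Affine.Point.some x y h →
      ∀ xf yf : ZMod ℓ, ladderRun V ℓ x₀ y₀ x y steps = some (xf, yf) →
      ∃ hf : (V.map (Int.castRingHom (ZMod ℓ))).toAffine.Nonsingular xf yf,
        (ladderScalar k steps) • (Affine.Point.some x₀ y₀ h₀ : (V.map (Int.castRingHom (ZMod ℓ))).toAffine.Point) =
          Affine.Point.some xf yf hf := by
  intro steps
  induction steps with
  | nil =>
    intro k x y h hk xf yf hrun
    simp only [ladderRun, Option.some.injEq, Prod.mk.injEq] at hrun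
    obtain ⟨rfl, rfl⟩ := hrun
    exact ⟨h, hk⟩
  | cons s rest ih =>
    intro k x y h hk xf yf hrun
    rw [show ladderScalar k (s :: rest) = ladderScalar (2 * k + (if s.bit then 1 else 0)) rest from rfl]
    simp only [ladderRun] at hrun
    split_ifs at hrun with hd hb hadd
    · -- double, then add the base point
      obtain ⟨hd', hdd⟩ := add_self_eq_of_dblOK h hd
      obtain ⟨ha', haa⟩ := add_eq_of_addOK hd' h₀ hadd
      rw [if_pos hb]
      refine ih (2 * k + 1) _ _ ha' ?_ xf yf hrun
      rw [succ_nsmul, two_mul, add_nsmul, hk, hdd, haa]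
    · -- double only
      obtain ⟨hd', hdd⟩ := add_self_eq_of_dblOK h hd
      rw [if_neg hb, add_zero]
      refine ih (2 * k) _ _ hd' ?_ xf yf hrun
      rw [two_mul, add_nsmul, hk, hdd]

/-- **The certificate's conclusion**: `ladderCheck ⟹ (ladderScalar 1 steps) • P₀ ≠ O` for some
`P₀ ∈ Ẽ(𝔽_ℓ)` (namely `(x₀, y₀)`; `ℓ ∤ Δ`, so the equation gives nonsingularity). [cite: SilvermanAEC2009, III.2.3] -/
theorem exists_nsmul_ne_zero_of_ladderCheck (x₀ y₀ : ℤ) (steps : List LadderStep)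
    (hcheck : ladderCheck V ℓ x₀ y₀ steps = true) (hℓΔ : ¬ (ℓ : ℤ) ∣ V.Δ) :
    ∃ P : (V.map (Int.castRingHom (ZMod ℓ))).toAffine.Point, (ladderScalar 1 steps) • P ≠ 0 := by
  obtain ⟨ha₁, ha₂, ha₃, ha₄, ha₆⟩ := map_a_eq V ℓ
  simp only [ladderCheck, Bool.and_eq_true, decide_eq_true_eq, Option.isSome_iff_exists] at hcheck
  obtain ⟨heq, ⟨xf, yf⟩, hrun⟩ := hcheck
  have hΔ : (V.map (Int.castRingHom (ZMod ℓ))).toAffine.Δ ≠ 0 := by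
    intro h
    have h' : ((V.Δ : ℤ) : ZMod ℓ) = 0 := by
      have := (V.map_Δ (Int.castRingHom (ZMod ℓ))).symm.trans h
      simpa using this
    exact hℓΔ ((ZMod.intCast_zmod_eq_zero_iff_dvd _ _).mp h')
  have h₀ : (V.map (Int.castRingHom (ZMod ℓ))).toAffine.Nonsingular (x₀ : ZMod ℓ) (y₀ : ZMod ℓ) := by
    refine (Affine.equation_iff_nonsingular_of_Δ_ne_zero hΔ).mp ((Affine.equation_iff _ _).mpr ?_)
    rw [ha₁, ha₂, ha₃, ha₄, ha₆]; exact heq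
  obtain ⟨hf, hP⟩ := ladderRun_sound h₀ steps 1 _ _ h₀ (one_nsmul _) xf yf hrun
  exact ⟨_, by rw [hP]; exact Affine.Point.some_ne_zero hf⟩

end Ladder

/-! ### §3 The record forms (literal integer model) and the level dispatcher -/

section Record

open Summit.BirchSwinnertonDyer.BirchSwinnertonDyer.Rank1Residual.X11RankOne (intCurve_Δ)

/-- **CYCLICITY `#Ẽ(𝔽_ℓ)[p] ≤ p` BY LADDER CERTIFICATE** for the literal model `[a₁,…,a₆]` at an odd prime
`ℓ ∤ Δ`: the schema count `countPoints [a₁,…,a₆] ℓ = n`, a point `(x₀, y₀)` and a ladder with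
`ladderScalar 1 steps · p = n` that runs to an AFFINE point (`ladderCheck`, decided in the kernel) give the
cyclicity binder of the offer shapes — also when `p² ∣ n`.  (The two decidable hypotheses are stated before
the `Fact` binders so that a record's `decide` goals are closed terms.) [cite: Kim2022StructureSelmer, §1.2.2 and Thm. 1.10 (1)] [cite: SilvermanAEC2009, III.2.3] -/
theorem card_torsion_le_of_ladder (a1 a2 a3 a4 a6 : ℤ) (ℓ p : ℕ) (x₀ y₀ : ℤ) (steps : List LadderStep)
    {n : ℕ} (hcheck : ladderCheck ⟨a1, a2, a3, a4, a6⟩ ℓ x₀ y₀ steps = true) (hm : ladderScalar 1 steps * p = n)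
    [Fact ℓ.Prime] [Fact p.Prime] (hℓ2 : ℓ ≠ 2) (hℓΔ : ¬ (ℓ : ℤ) ∣ discOf [a1, a2, a3, a4, a6])
    (hc : countPoints [a1, a2, a3, a4, a6] ℓ = n) :
    Nat.card {P : (((⟨a1, a2, a3, a4, a6⟩ : WeierstrassCurve ℤ)).map
        (Int.castRingHom (ZMod ℓ))).toAffine.Point // p • P = 0} ≤ p := by
  have hp : p.Prime := Fact.out
  have hN := natCard_point_eq_of_countPoints a1 a2 a3 a4 a6 ℓ hℓ2 hℓΔ hc
  have hΔ : ¬ (ℓ : ℤ) ∣ (⟨a1, a2, a3, a4, a6⟩ : WeierstrassCurve ℤ).Δ := by rw [intCurve_Δ]; exact hℓΔ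
  obtain ⟨P, hP⟩ := exists_nsmul_ne_zero_of_ladderCheck x₀ y₀ steps hcheck hΔ
  haveI : Finite ((((⟨a1, a2, a3, a4, a6⟩ : WeierstrassCurve ℤ)).map
      (Int.castRingHom (ZMod ℓ))).toAffine.Point) := by
    refine Nat.finite_of_card_ne_zero ?_
    rw [hN, ← hm]
    exact Nat.mul_ne_zero (fun h => hP (by rw [h, zero_nsmul])) hp.ne_zero
  refine natCard_torsion_le_of_nsmul_ne_zero hp hN (g := P) ?_
  rwa [← hm, Nat.mul_div_cancel _ hp.pos]

/-- **CYCLICITY `#Ẽ(𝔽_ℓ)[p] ≤ p` BY POINT COUNT** for the literal model: `countPoints [a₁,…,a₆] ℓ = n` with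
`p² ∤ n` (the tree's `Additive.card_torsion_le_of_intModel_of_card`, literal-model form). [cite: Kim2022StructureSelmer, §1.2.2 and Thm. 1.10 (1)] -/
theorem card_torsion_le_of_count (a1 a2 a3 a4 a6 : ℤ) (ℓ p : ℕ) [Fact ℓ.Prime] [Fact p.Prime]
    (hℓ2 : ℓ ≠ 2) (hℓΔ : ¬ (ℓ : ℤ) ∣ discOf [a1, a2, a3, a4, a6]) {n : ℕ}
    (hc : countPoints [a1, a2, a3, a4, a6] ℓ = n) (hsq : ¬ p ^ 2 ∣ n) :
    Nat.card {P : (((⟨a1, a2, a3, a4, a6⟩ : WeierstrassCurve ℤ)).map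
        (Int.castRingHom (ZMod ℓ))).toAffine.Point // p • P = 0} ≤ p := by
  have hN := natCard_point_eq_of_countPoints a1 a2 a3 a4 a6 ℓ hℓ2 hℓΔ hc
  haveI : Finite ((((⟨a1, a2, a3, a4, a6⟩ : WeierstrassCurve ℤ)).map
      (Int.castRingHom (ZMod ℓ))).toAffine.Point) :=
    Nat.finite_of_card_ne_zero (by rw [hN]; rintro rfl; exact hsq (dvd_zero _))
  exact natCard_torsion_le_of_not_sq_dvd Fact.out (by rwa [hN])

/-- **Level dispatcher (literal model, level as a numeral)**: `n = ℓ₁ℓ₂` and the two per-prime bounds give the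
`hcyc` binder of the offer shapes at the level `n` in the exact form the records quantify (`ℓ ∣ n`), whatever
certificate produced each bound. [cite: Kim2022StructureSelmer, §1.2.2 and Thm. 1.10 (1)] -/
theorem forall_card_torsion_le_of_level (V : WeierstrassCurve ℤ) (p n ℓ₁ ℓ₂ : ℕ) (hn : n = ℓ₁ * ℓ₂)
    [Fact ℓ₁.Prime] [Fact ℓ₂.Prime]
    (h₁ : Nat.card {P : (V.map (Int.castRingHom (ZMod ℓ₁))).toAffine.Point // p • P = 0} ≤ p)
    (h₂ : Nat.card {P : (V.map (Int.castRingHom (ZMod ℓ₂))).toAffine.Point // p • P = 0} ≤ p) :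
    ∀ (ℓ : ℕ) [Fact ℓ.Prime], ℓ ∣ n →
      Nat.card {P : (V.map (Int.castRingHom (ZMod ℓ))).toAffine.Point // p • P = 0} ≤ p := by
  subst hn
  intro ℓ hℓ hdvd
  rcases (Nat.Prime.dvd_mul hℓ.out).mp hdvd with hd | hd
  · obtain rfl := (Nat.prime_dvd_prime_iff_eq hℓ.out Fact.out).mp hd
    exact h₁
  · obtain rfl := (Nat.prime_dvd_prime_iff_eq hℓ.out Fact.out).mp hd
    exact h₂

/-- **Prime level**: the one bound gives the `hcyc` binder at a prime level `n = ℓ₁` (rank-one / `k = 2` shapes).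
[cite: Kim2022StructureSelmer, §1.2.2 and Thm. 1.10 (1)] -/
theorem forall_card_torsion_le_of_prime_level (V : WeierstrassCurve ℤ) (p ℓ₁ : ℕ) [Fact ℓ₁.Prime]
    (h₁ : Nat.card {P : (V.map (Int.castRingHom (ZMod ℓ₁))).toAffine.Point // p • P = 0} ≤ p) :
    ∀ (ℓ : ℕ) [Fact ℓ.Prime], ℓ ∣ ℓ₁ →
      Nat.card {P : (V.map (Int.castRingHom (ZMod ℓ))).toAffine.Point // p • P = 0} ≤ p := by
  intro ℓ hℓ hdvd
  obtain rfl := (Nat.prime_dvd_prime_iff_eq hℓ.out Fact.out).mp hdvd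
  exact h₁

end Record

/-! ### §4 Sanity instances (kernel `decide`) -/

section Sanity

/-- Sanity (kernel `decide`): the N4 cell `64883c1 @ 5`, level prime `ℓ = 271` (`#Ẽ(𝔽₂₇₁) = 300 = 2²·3·5²`, the
count is silent): `60 • (2, 18) ≠ O` by a five-step ladder (`60 = 111100₂`), hence `#Ẽ(𝔽₂₇₁)[5] ≤ 5` — the `hcyc`
binder of `bsdp_x6r0_64883c1_5` at `ℓ = 271`. [cite: Kim2022StructureSelmer, §1.2.2 and Thm. 1.10 (1)] [cite: SilvermanAEC2009, III.2.3] -/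
theorem card_torsion_le_sample [Fact (Nat.Prime 271)] [Fact (Nat.Prime 5)] :
    Nat.card {P : (((⟨0, 0, 1, -293439730, -1934759231321⟩ : WeierstrassCurve ℤ)).map
        (Int.castRingHom (ZMod 271))).toAffine.Point // 5 • P = 0} ≤ 5 :=
  card_torsion_le_of_ladder 0 0 1 (-293439730) (-1934759231321) 271 5 2 18
    [⟨true, 129, 106, 115, 212, 121, 227⟩, ⟨true, 188, 143, 243, 238, 131, 173⟩, ⟨true, 141, 107, 229, 193, 13, 26⟩,
      ⟨false, 217, 180, 48, 0, 0, 0⟩, ⟨false, 213, 23, 59, 0, 0, 0⟩]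
    (by decide +kernel) (by decide) (by decide) (by decide +kernel) (n := 300) (by decide +kernel)

end Sanity

end Summit.BirchSwinnertonDyer.Rank1Residual.Supersingular
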